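import Summits.QuantumFields.YangMills.Theorems.ColdStartUniversalityLatticeLangevinFrameBochner
import HarnessLib

/-!
# Route `ColdStartUniversality` (fixed-cut-off package, Bakry–Émery side, log-Sobolev half): the POINTWISE BOCHNER FORMULA
# for a frame generator

Helper file (seat `ym-line-csu-p1`, g26; `--supports stmt-QuantumFields-24809`).  Abstract setting of `…FrameCalculus` /
`…FrameBochner`: a real normed space `E`, a finite frame of continuous LINEAR vector fields `s : ι → E →L[ℝ] E` closing under
brackets (`s_m(s_n y) − s_n(s_m y) = Σ_k c_{nmk} s_k y`, `c` antisymmetric in its last two slots), a potential `ψ`, the frame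
derivatives `W_n f (y) = Df(y)[s_n y]`, the frame generator `𝓛f = Σ_n (W_nW_n f + W_nψ · W_n f)` and its carré du champ
`Γ(f) = Σ_n (W_n f)²`.  Contents:

* §1 pointwise calculus: `W_n Γ(h)`, `W_nW_n Γ(h)`, the diffusion chain rule ★ `frameGen_exp`: `𝓛(e^u) = e^u (𝓛u + Γ(u))`, `Γ(e^u) = e^{2u}Γ(u)`;
* §2 ★★ `frameGammaTwo_pointwise` — BOCHNER'S FORMULA, POINTWISE (`h ∈ C³`, `ψ ∈ C²`):
    `½ 𝓛(Γh) − Γ(h, 𝓛h) = Σ_{n,m} (W_mW_n h)² − Σ_{n,m} W_nh · W_mh · W_nW_mψ`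
  at EVERY point (the third-order terms cancel by `FrameCalculus` Cancellation I, the first-order drift terms by Cancellation II;
  the Ricci curvature of the frame sits in the antisymmetric part of `(W_mW_nh)`).  `…FrameBochner` proved only the integral of this
  identity against the invariant measure; the pointwise form is what the log-Sobolev half of the Bakry–Émery theorem needs
  (Bakry–Émery 1985; Bakry–Gentil–Ledoux 2014, (1.16.3), (C.5.3), Prop. 5.7.3).
THEOREMS ONLY, no definition, no sorry; all [folklore].  HONEST FRAMING: abstract calculus; no statement about Yang–Mills; nothing
K-uniform; the YM mass gap is NOT proved.
-/

set_option autoImplicit false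

noncomputable section

namespace Summit.QuantumFields.YangMills.Theorems.ColdStartUniversality

open Finset MeasureTheory
open scoped BigOperators

variable {E : Type*} [NormedAddCommGroup E] [NormedSpace ℝ E]
variable {ι : Type*} [Fintype ι]

/-! ## §1. Pointwise calculus of the carré du champ and the exponential -/

/-- `∂_v (Σ_m (W_m h)²) = Σ_m 2 W_mh · ∂_v(W_mh)` for `h ∈ C²`. [folklore] -/
theorem fderiv_carre_apply {h : E → ℝ} (hh : ContDiff ℝ 2 h) (s : ι → E →L[ℝ] E) (y v : E) :
    fderiv ℝ (fun w => ∑ m, (fderiv ℝ h w (s m w)) ^ 2) y v =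
      ∑ m, 2 * fderiv ℝ h y (s m y) * fderiv ℝ (fun z => fderiv ℝ h z (s m z)) y v := by
  have hd : ∀ m, DifferentiableAt ℝ (fun z => fderiv ℝ h z (s m z)) y := fun m => differentiableAt_frameDeriv hh (s m) y
  have h1 : (fun w => ∑ m, (fderiv ℝ h w (s m w)) ^ 2) =
      fun w => ∑ m, fderiv ℝ h w (s m w) * fderiv ℝ h w (s m w) := by
    funext w; simp only [sq]
  rw [h1, frameDeriv_sum Finset.univ (f := fun m w => fderiv ℝ h w (s m w) * fderiv ℝ h w (s m w))
    (fun m _ => (hd m).mul (hd m))]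
  refine Finset.sum_congr rfl fun m _ => ?_
  rw [fderiv_mul_apply_dir (hd m) (hd m)]
  ring

/-- `W_nW_n (Σ_m (W_m h)²) = Σ_m (2 (W_nW_m h)² + 2 W_mh · W_nW_nW_m h)` for `h ∈ C³`. [folklore] -/
theorem frameDeriv_frameDeriv_carre {h : E → ℝ} (hh : ContDiff ℝ 3 h) (s : ι → E →L[ℝ] E) (n : ι) (y : E) :
    fderiv ℝ (fun z => fderiv ℝ (fun w => ∑ m, (fderiv ℝ h w (s m w)) ^ 2) z (s n z)) y (s n y) =
      ∑ m, (2 * (fderiv ℝ (fun z => fderiv ℝ h z (s m z)) y (s n y)) ^ 2 +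
        2 * fderiv ℝ h y (s m y) *
          fderiv ℝ (fun z => fderiv ℝ (fun w => fderiv ℝ h w (s m w)) z (s n z)) y (s n y)) := by
  have hh2 : ContDiff ℝ 2 h := hh.of_le (by norm_num)
  have hW2 : ∀ m, ContDiff ℝ 2 (fun z => fderiv ℝ h z (s m z)) := fun m => contDiff_frameDeriv (k := 2) hh (s m)
  have hWW1 : ∀ m, ContDiff ℝ 1 (fun z => fderiv ℝ (fun w => fderiv ℝ h w (s m w)) z (s n z)) :=
    fun m => contDiff_frameDeriv (k := 1) (hW2 m) (s n)
  have hfun : (fun z => fderiv ℝ (fun w => ∑ m, (fderiv ℝ h w (s m w)) ^ 2) z (s n z)) =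
      fun z => ∑ m, 2 * (fderiv ℝ h z (s m z) *
        fderiv ℝ (fun w => fderiv ℝ h w (s m w)) z (s n z)) := by
    funext z
    rw [fderiv_carre_apply hh2 s z (s n z)]
    refine Finset.sum_congr rfl fun m _ => ?_
    ring
  rw [hfun]
  have hd1 : ∀ m, DifferentiableAt ℝ (fun z => fderiv ℝ h z (s m z)) y :=
    fun m => differentiableAt_frameDeriv hh2 (s m) y
  have hd2 : ∀ m, DifferentiableAt ℝ (fun z => fderiv ℝ (fun w => fderiv ℝ h w (s m w)) z (s n z)) y :=
    fun m => ((hWW1 m).differentiable (by norm_num)).differentiableAt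
  rw [fderiv_sum_mul_apply Finset.univ (fun _ => (2 : ℝ))
    (f := fun m z => fderiv ℝ h z (s m z) * fderiv ℝ (fun w => fderiv ℝ h w (s m w)) z (s n z))
    (fun m _ => (hd1 m).mul (hd2 m)) (s n y)]
  refine Finset.sum_congr rfl fun m _ => ?_
  rw [fderiv_mul_apply_dir (hd1 m) (hd2 m)]
  ring

/-- ★ **Diffusion chain rule for the frame generator**: `𝓛(e^u) = e^u (𝓛u + Γ(u))`, i.e.
`Σ_n (W_nW_n e^u + W_nψ W_n e^u) = e^u (Σ_n (W_nW_n u + W_nψ W_n u) + Σ_n (W_n u)²)` for `u ∈ C²`. [folklore] -/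
theorem frameGen_exp {u : E → ℝ} (ψ : E → ℝ) (hu : ContDiff ℝ 2 u) (s : ι → E →L[ℝ] E) (y : E) :
    ∑ n, (fderiv ℝ (fun z => fderiv ℝ (fun z' => Real.exp (u z')) z (s n z)) y (s n y) +
        fderiv ℝ ψ y (s n y) * fderiv ℝ (fun z' => Real.exp (u z')) y (s n y)) =
      Real.exp (u y) * ((∑ n, (fderiv ℝ (fun z => fderiv ℝ u z (s n z)) y (s n y) +
        fderiv ℝ ψ y (s n y) * fderiv ℝ u y (s n y))) + ∑ n, (fderiv ℝ u y (s n y)) ^ 2) := by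
  have hud : Differentiable ℝ u := hu.differentiable (by norm_num)
  rw [mul_add, Finset.mul_sum, Finset.mul_sum, ← Finset.sum_add_distrib]
  refine Finset.sum_congr rfl fun n _ => ?_
  rw [fderiv_frameDeriv_exp hu (s n) y (s n y), frameDeriv_exp (hud y)]
  ring

/-- Frame derivative of the exponential, squared and summed: `Γ(e^u) = e^{2u} Γ(u)`, written as
`Σ_n (W_n e^u)² = e^u · e^u · Σ_n (W_n u)²`. [folklore] -/
theorem carre_exp {u : E → ℝ} {y : E} (hu : DifferentiableAt ℝ u y) (s : ι → E →L[ℝ] E) :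
    ∑ n, (fderiv ℝ (fun z' => Real.exp (u z')) y (s n y)) ^ 2 =
      Real.exp (u y) * Real.exp (u y) * ∑ n, (fderiv ℝ u y (s n y)) ^ 2 := by
  rw [Finset.mul_sum]
  refine Finset.sum_congr rfl fun n _ => ?_
  rw [frameDeriv_exp hu]
  ring

/-! ## §2. Bochner's formula, pointwise -/

/-- ★★ **Bochner's formula for a frame generator, POINTWISE.**  For a frame `s` with bracket relation
`s_m(s_n y) − s_n(s_m y) = Σ_k c_{nmk} s_k y`, `c` antisymmetric in its last two slots, a `C²` potential `ψ` and `h ∈ C³`, at every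
point `y`:
`½·𝓛(Γh)(y) − Γ(h, 𝓛h)(y) = Σ_{n,m} (W_mW_n h (y))² − Σ_{n,m} W_nh(y) W_mh(y) W_nW_mψ(y)`,
where `Γh = Σ_m (W_m h)²`, `𝓛f = Σ_n (W_nW_n f + W_nψ·W_n f)` and `Γ(h, 𝓛h) = Σ_n W_nh · W_n(𝓛h)`.
(Bakry–Émery's `Γ₂ = ‖∇²h‖² + (Ric − ∇²ψ)(∇h,∇h)` on a Lie group with an invariant frame, the Ricci term being carried by the
antisymmetric part of `(W_mW_n h)`; Bakry–Gentil–Ledoux 2014, (1.16.3), (C.5.3).) [folklore] -/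
theorem frameGammaTwo_pointwise {h ψ : E → ℝ} (hh : ContDiff ℝ 3 h) (hψ : ContDiff ℝ 2 ψ) (s : ι → E →L[ℝ] E)
    (c : ι → ι → ι → ℝ) (hs : ∀ n m y, s m (s n y) - s n (s m y) = ∑ k, c n m k • s k y)
    (hc : ∀ n m k, c n m k = -c n k m) (y : E) :
    (1 / 2 : ℝ) * ∑ n, (fderiv ℝ (fun z => fderiv ℝ (fun w => ∑ m, (fderiv ℝ h w (s m w)) ^ 2) z (s n z)) y (s n y) +
        fderiv ℝ ψ y (s n y) * fderiv ℝ (fun w => ∑ m, (fderiv ℝ h w (s m w)) ^ 2) y (s n y)) -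
      ∑ n, fderiv ℝ h y (s n y) *
        fderiv ℝ (fun z => ∑ m, (fderiv ℝ (fun w => fderiv ℝ h w (s m w)) z (s m z) +
          fderiv ℝ ψ z (s m z) * fderiv ℝ h z (s m z))) y (s n y) =
    ∑ n, ∑ m, (fderiv ℝ (fun z => fderiv ℝ h z (s n z)) y (s m y)) ^ 2 -
      ∑ n, ∑ m, fderiv ℝ h y (s n y) * fderiv ℝ h y (s m y) *
        fderiv ℝ (fun z => fderiv ℝ ψ z (s m z)) y (s n y) := by
  have hh2 : ContDiff ℝ 2 h := hh.of_le (by norm_num)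
  have hW2 : ∀ m, ContDiff ℝ 2 (fun z => fderiv ℝ h z (s m z)) := fun m => contDiff_frameDeriv (k := 2) hh (s m)
  have hWW1 : ∀ m n, ContDiff ℝ 1 (fun z => fderiv ℝ (fun w => fderiv ℝ h w (s m w)) z (s n z)) :=
    fun m n => contDiff_frameDeriv (k := 1) (hW2 m) (s n)
  have hWψ1 : ∀ m, ContDiff ℝ 1 (fun z => fderiv ℝ ψ z (s m z)) := fun m => contDiff_frameDeriv (k := 1) hψ (s m)
  -- (a), (b): first and second frame derivatives of the carré du champ
  have hA : ∀ n, fderiv ℝ (fun w => ∑ m, (fderiv ℝ h w (s m w)) ^ 2) y (s n y) =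
      ∑ m, 2 * fderiv ℝ h y (s m y) * fderiv ℝ (fun z => fderiv ℝ h z (s m z)) y (s n y) :=
    fun n => fderiv_carre_apply hh2 s y (s n y)
  have hB : ∀ n, fderiv ℝ (fun z => fderiv ℝ (fun w => ∑ m, (fderiv ℝ h w (s m w)) ^ 2) z (s n z)) y (s n y) =
      ∑ m, (2 * (fderiv ℝ (fun z => fderiv ℝ h z (s m z)) y (s n y)) ^ 2 +
        2 * fderiv ℝ h y (s m y) *
          fderiv ℝ (fun z => fderiv ℝ (fun w => fderiv ℝ h w (s m w)) z (s n z)) y (s n y)) :=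
    fun n => frameDeriv_frameDeriv_carre hh s n y
  -- (c): frame derivative of the frame generator
  have hC : ∀ n, fderiv ℝ (fun z => ∑ m, (fderiv ℝ (fun w => fderiv ℝ h w (s m w)) z (s m z) +
      fderiv ℝ ψ z (s m z) * fderiv ℝ h z (s m z))) y (s n y) =
      ∑ m, (fderiv ℝ (fun z => fderiv ℝ (fun w => fderiv ℝ h w (s m w)) z (s m z)) y (s n y) +
        (fderiv ℝ ψ y (s m y) * fderiv ℝ (fun z => fderiv ℝ h z (s m z)) y (s n y) +
          fderiv ℝ h y (s m y) * fderiv ℝ (fun z => fderiv ℝ ψ z (s m z)) y (s n y))) := by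
    intro n
    have hd1 : ∀ m, DifferentiableAt ℝ (fun z => fderiv ℝ (fun w => fderiv ℝ h w (s m w)) z (s m z)) y :=
      fun m => ((hWW1 m m).differentiable (by norm_num)).differentiableAt
    have hd2 : ∀ m, DifferentiableAt ℝ (fun z => fderiv ℝ ψ z (s m z)) y :=
      fun m => ((hWψ1 m).differentiable (by norm_num)).differentiableAt
    have hd3 : ∀ m, DifferentiableAt ℝ (fun z => fderiv ℝ h z (s m z)) y :=
      fun m => ((hW2 m).differentiable (by norm_num)).differentiableAt
    have hd23 : ∀ m, DifferentiableAt ℝ (fun z => fderiv ℝ ψ z (s m z) * fderiv ℝ h z (s m z)) y :=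
      fun m => (hd2 m).mul (hd3 m)
    have hd4 : ∀ m, DifferentiableAt ℝ (fun z => fderiv ℝ (fun w => fderiv ℝ h w (s m w)) z (s m z) +
        fderiv ℝ ψ z (s m z) * fderiv ℝ h z (s m z)) y := fun m => (hd1 m).add (hd23 m)
    rw [frameDeriv_sum Finset.univ (f := fun m z => fderiv ℝ (fun w => fderiv ℝ h w (s m w)) z (s m z) +
        fderiv ℝ ψ z (s m z) * fderiv ℝ h z (s m z)) (fun m _ => hd4 m)]
    refine Finset.sum_congr rfl fun m _ => ?_
    rw [fderiv_fun_add (hd1 m) (hd23 m), add_apply, fderiv_mul_apply_dir (hd2 m) (hd3 m)]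
  -- the two cancellations of `…FrameCalculus`
  have hI : ∑ n, ∑ m, fderiv ℝ h y (s n y) *
      (fderiv ℝ (fun z => fderiv ℝ (fun w => fderiv ℝ h w (s m w)) z (s m z)) y (s n y) -
        fderiv ℝ (fun z => fderiv ℝ (fun w => fderiv ℝ h w (s n w)) z (s m z)) y (s m y)) = 0 :=
    sum_sum_frameDeriv_mul_comm_sq_eq_zero hh s c hs hc y
  have hII : ∑ n, ∑ m, fderiv ℝ h y (s n y) * fderiv ℝ ψ y (s m y) *
      (fderiv ℝ (fun z => fderiv ℝ h z (s n z)) y (s m y) - fderiv ℝ (fun z => fderiv ℝ h z (s m z)) y (s n y)) = 0 :=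
    sum_sum_frameDeriv_mul_mul_comm_eq_zero (ψ := ψ) hh2 s c hs hc y
  -- named double sums
  set S1 : ℝ := ∑ n, ∑ m, (fderiv ℝ (fun z => fderiv ℝ h z (s m z)) y (s n y)) ^ 2 with hS1
  set S1' : ℝ := ∑ n, ∑ m, (fderiv ℝ (fun z => fderiv ℝ h z (s n z)) y (s m y)) ^ 2 with hS1'
  set S2 : ℝ := ∑ n, ∑ m, fderiv ℝ h y (s m y) *
    fderiv ℝ (fun z => fderiv ℝ (fun w => fderiv ℝ h w (s m w)) z (s n z)) y (s n y) with hS2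
  set S2' : ℝ := ∑ n, ∑ m, fderiv ℝ h y (s n y) *
    fderiv ℝ (fun z => fderiv ℝ (fun w => fderiv ℝ h w (s n w)) z (s m z)) y (s m y) with hS2'
  set S3 : ℝ := ∑ n, ∑ m, fderiv ℝ ψ y (s n y) * fderiv ℝ h y (s m y) *
    fderiv ℝ (fun z => fderiv ℝ h z (s m z)) y (s n y) with hS3
  set S3' : ℝ := ∑ n, ∑ m, fderiv ℝ ψ y (s m y) * fderiv ℝ h y (s n y) *
    fderiv ℝ (fun z => fderiv ℝ h z (s n z)) y (s m y) with hS3'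
  set S4 : ℝ := ∑ n, ∑ m, fderiv ℝ h y (s n y) *
    fderiv ℝ (fun z => fderiv ℝ (fun w => fderiv ℝ h w (s m w)) z (s m z)) y (s n y) with hS4
  set S5 : ℝ := ∑ n, ∑ m, fderiv ℝ h y (s n y) * fderiv ℝ ψ y (s m y) *
    fderiv ℝ (fun z => fderiv ℝ h z (s m z)) y (s n y) with hS5
  set S6 : ℝ := ∑ n, ∑ m, fderiv ℝ h y (s n y) * fderiv ℝ h y (s m y) *
    fderiv ℝ (fun z => fderiv ℝ ψ z (s m z)) y (s n y) with hS6
  have e11 : S1 = S1' := Finset.sum_comm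
  have e22 : S2 = S2' := Finset.sum_comm
  have e33 : S3 = S3' := Finset.sum_comm
  have hI' : S4 - S2' = 0 := by
    rw [← hI, hS4, hS2', ← Finset.sum_sub_distrib]
    refine Finset.sum_congr rfl fun n _ => ?_
    rw [← Finset.sum_sub_distrib]
    refine Finset.sum_congr rfl fun m _ => ?_
    ring
  have hII' : S3' - S5 = 0 := by
    rw [← hII, hS3', hS5, ← Finset.sum_sub_distrib]
    refine Finset.sum_congr rfl fun n _ => ?_
    rw [← Finset.sum_sub_distrib]
    refine Finset.sum_congr rfl fun m _ => ?_
    ring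
  -- the left-hand side in terms of the named sums
  have q1 : ∀ n, ∑ m, (2 * (fderiv ℝ (fun z => fderiv ℝ h z (s m z)) y (s n y)) ^ 2 +
        2 * fderiv ℝ h y (s m y) *
          fderiv ℝ (fun z => fderiv ℝ (fun w => fderiv ℝ h w (s m w)) z (s n z)) y (s n y)) =
      2 * ∑ m, (fderiv ℝ (fun z => fderiv ℝ h z (s m z)) y (s n y)) ^ 2 +
        2 * ∑ m, fderiv ℝ h y (s m y) *
          fderiv ℝ (fun z => fderiv ℝ (fun w => fderiv ℝ h w (s m w)) z (s n z)) y (s n y) := by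
    intro n
    rw [Finset.mul_sum, Finset.mul_sum, ← Finset.sum_add_distrib]
    exact Finset.sum_congr rfl fun m _ => by ring
  have q2 : ∀ n, fderiv ℝ ψ y (s n y) * ∑ m, 2 * fderiv ℝ h y (s m y) * fderiv ℝ (fun z => fderiv ℝ h z (s m z)) y (s n y) =
      2 * ∑ m, fderiv ℝ ψ y (s n y) * fderiv ℝ h y (s m y) * fderiv ℝ (fun z => fderiv ℝ h z (s m z)) y (s n y) := by
    intro n
    rw [Finset.mul_sum, Finset.mul_sum]
    exact Finset.sum_congr rfl fun m _ => by ring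
  have eL1 : (1 / 2 : ℝ) * ∑ n, (fderiv ℝ (fun z => fderiv ℝ (fun w => ∑ m, (fderiv ℝ h w (s m w)) ^ 2) z (s n z)) y (s n y) +
        fderiv ℝ ψ y (s n y) * fderiv ℝ (fun w => ∑ m, (fderiv ℝ h w (s m w)) ^ 2) y (s n y)) = S1 + S2 + S3 := by
    simp_rw [hB, hA, q1, q2]
    have q3 : ∀ n, 2 * ∑ m, (fderiv ℝ (fun z => fderiv ℝ h z (s m z)) y (s n y)) ^ 2 +
        2 * ∑ m, fderiv ℝ h y (s m y) *
          fderiv ℝ (fun z => fderiv ℝ (fun w => fderiv ℝ h w (s m w)) z (s n z)) y (s n y) +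
        2 * ∑ m, fderiv ℝ ψ y (s n y) * fderiv ℝ h y (s m y) * fderiv ℝ (fun z => fderiv ℝ h z (s m z)) y (s n y) =
        2 * ((∑ m, (fderiv ℝ (fun z => fderiv ℝ h z (s m z)) y (s n y)) ^ 2) +
          (∑ m, fderiv ℝ h y (s m y) *
            fderiv ℝ (fun z => fderiv ℝ (fun w => fderiv ℝ h w (s m w)) z (s n z)) y (s n y)) +
          ∑ m, fderiv ℝ ψ y (s n y) * fderiv ℝ h y (s m y) * fderiv ℝ (fun z => fderiv ℝ h z (s m z)) y (s n y)) :=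
      fun n => by ring
    simp_rw [q3]
    rw [← Finset.mul_sum, Finset.sum_add_distrib, Finset.sum_add_distrib, hS1, hS2, hS3]
    ring
  have q4 : ∀ n, fderiv ℝ h y (s n y) *
      ∑ m, (fderiv ℝ (fun z => fderiv ℝ (fun w => fderiv ℝ h w (s m w)) z (s m z)) y (s n y) +
        (fderiv ℝ ψ y (s m y) * fderiv ℝ (fun z => fderiv ℝ h z (s m z)) y (s n y) +
          fderiv ℝ h y (s m y) * fderiv ℝ (fun z => fderiv ℝ ψ z (s m z)) y (s n y))) =
      ∑ m, fderiv ℝ h y (s n y) *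
          fderiv ℝ (fun z => fderiv ℝ (fun w => fderiv ℝ h w (s m w)) z (s m z)) y (s n y) +
        ∑ m, fderiv ℝ h y (s n y) * fderiv ℝ ψ y (s m y) * fderiv ℝ (fun z => fderiv ℝ h z (s m z)) y (s n y) +
        ∑ m, fderiv ℝ h y (s n y) * fderiv ℝ h y (s m y) * fderiv ℝ (fun z => fderiv ℝ ψ z (s m z)) y (s n y) := by
    intro n
    rw [Finset.mul_sum, ← Finset.sum_add_distrib, ← Finset.sum_add_distrib]
    exact Finset.sum_congr rfl fun m _ => by ring
  have eL2 : ∑ n, fderiv ℝ h y (s n y) *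
        fderiv ℝ (fun z => ∑ m, (fderiv ℝ (fun w => fderiv ℝ h w (s m w)) z (s m z) +
          fderiv ℝ ψ z (s m z) * fderiv ℝ h z (s m z))) y (s n y) = S4 + S5 + S6 := by
    simp_rw [hC, q4]
    rw [Finset.sum_add_distrib, Finset.sum_add_distrib, hS4, hS5, hS6]
  rw [eL1, eL2]
  linarith [e11, e22, e33, hI', hII']

end Summit.QuantumFields.YangMills.Theorems.ColdStartUniversality
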